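import Summits.ABC.IUTFork.Repair.CandInternal2RealLabelsLicence
import Summits.ABC.IUTFork.Cor312LicenceTameBoundary
import HarnessLib

/-!
# IUT REPAIR branch → R-H (D-0079 «local-height I06⋆»), part 3: the REAL I06⋆ cell JOINED to the (xi-f) licence cell at ALL
# BALL-SHAPED fibres (R-W strata U1 ∪ U1½: `log_p 𝒪_x^× = 𝔪_x`, `p` odd — tame, and the boundary `e = p − 1` without `ζ_p`)

PROOF-ONLY k2-engine file (D-0012: 0 definitions, 0 `Prop` facts, no instance, no notation) of the abc-iut cell, rung LADDER-ABC:A2.RESCUE.H;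
seat abc-iut-w5-d068 gen 6 (k2 hand; claim «RH-BALL-JOIN», STATUS 16:3xZ). TAKES NO SIDE on [IUTchIII] Cor. 3.12 or on any author; RP-I06⋆ is
abc-iut-rp-d2's CANDIDATE READING (a bound hypothesis, never asserted); typed ≠ proved; instantiated ≠ endorsed; refuted-as-typed ≠ refuted-in-print.
INPUTS, BY NAME (nothing re-typed): parts 1–2 (`CandInternal2RealLabelsLicence(GenuineK)`, p453930/p455320/p454529: the TAME sandwich «real
I06⋆ cell ⟹ licence cell ⟹ linear shell cell» and the licence cell exactly in I06⋆ currency); abc-iut-D1-prv's BALL dichotomy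
`Thm311.Real.qRegion_subset_thetaHull_settingDHVolSharp_iff_of_ball_orders` / `licence_settingPrVolSharp_iff_of_ball_orders`
(`Cor312LicenceTameBoundary`, p456193: the tame integer predicate VERBATIM, tameness replaced by the ball hypothesis `log_p 𝒪_x^× = {‖y‖ ≤ ‖ϖ_x‖}`);
abc-iut-w5-d009's legs `tame_exact_iff_emod` / `tame_exact_of_sufficient_leg` / `necessary_leg_of_tame_exact`; abc-iut-rp-d2's real shell
(`CandInternal2RealLabels`, p450037) and abc-iut-S1/L4's `logShell_ofUnitLog` (`ℐ_K = (p*)⁻¹·log_p 𝒪_K^×`).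
CONTENT. §1 (`K` any MLF over `ℚ_p`, `p ≠ 2`, `log_p 𝒪_K^× = 𝔪_K`): `logShell_eq_closedBall_of_ball` (`ℐ_K = {‖y‖ ≤ ‖ϖ‖^{1−e}}`) and
**`mem_pow_smul_logShell_iff_int_of_ball`** (`q ∈ qⁿ·ℐ_K ⟺ (n−1)·m ≤ e−1`) — the I06⋆ column's «ball-shell closed form» as ONE kernel iff,
NO `e ≤ p − 2`. §2 one uniformly-indexed ball fibre over an odd prime, honest exponents `‖t_{Θ,j,w}‖ = ‖ϖ_w‖^{j²m_q(w)}`, `‖t_{q,w}‖ = ‖ϖ_w‖^{m_q(w)}`,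
`m_q ≥ 1`: (A) **`qRegion_subset_thetaHull_settingDHVolSharp_of_realStar_ball`** (I06⋆ cells at every `w | p` ⟹ licence cell at `(j, p)`),
**`realLinear_of_qRegion_subset_thetaHull_settingDHVolSharp_ball`** (licence cell ⟹ LINEAR shell cells), (B)
**`qRegion_subset_thetaHull_settingDHVolSharp_iff_emod_ball`** (licence cell `⟺ ∀ w | p, (j²−1)·m_q(w) − j·(e−1) ≤ (j²m_q(w) − 1) mod e`).
§3 all bad fibres uniform ball fibres over odd primes: `licence_settingPrVolSharp_of_realStar_ball`,
**`exists_qPinned_and_hull_settingPrVolSharp_of_realStar_ball`** (branch C's S_H antecedent from the I06⋆ cells), `realLinear_of_licence_settingPrVolSharp_ball`.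
READING (START-HERE v1.1 §1–§3; neutral): the stratum boundary `e = p − 2 | p − 1` is invisible to BOTH columns as long as the unit-log shell
stays a ball — on every ball row the I06⋆ cell is `(j²−1)·m_q ≤ e−1`, the licence cell is `(j²−1)·m_q ≤ j(e−1) + ((j²m_q−1) mod e)`, and
QUADRATIC ⟹ LICENCE ⟹ LINEAR as on the tame stratum (band `θ_j ∈ [1, j]`); the genuinely open cells are the NON-ball (deep, `ζ_p`) ones.
HONEST SCOPE (binding): OUR sharp containers (Θ-regions constant in `m`), Dupuy–Hilado's typed (Ind1)/(Ind2) per (capsule slot, place); the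
packet-level / hull-level licence is a STRONGER-THAN-PRINT form of Step (xi-f); nothing about the printed GLOBAL inequality or the NUMBER-level
corollary; nothing asserts or refutes [IUTchIII] Cor. 3.12. [cite: Mochizuki2012, IUTchIII Cor. 3.12 p. 173–174, Step (xi-f) p. 184; IUTchIV Prop. 1.2
(i)(ii) p. 10] [cite: MochizukiAbsTopIII2015, Def 5.4 (iii) p. 126] [cite: NeukirchANT1999, Ch. II Prop. (5.5)–(5.7)] [cite: DupuyHilado2025, §3.4, §3.9,
§4.9] [cite: ScholzeStix2018, §2.2 pp. 9–10] [claim: Mochizuki2012, status: disputed] for every IUT sentence quoted. Axioms: standard.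
-/

noncomputable section

open Set Metric Function NumberField IsDedekindDomain
open scoped Pointwise

namespace Summit.ABC.IUTFork.Repair.CandInternal2RealLabelsLicenceBall

open Literature.AnabelianGeometry.AbsoluteAnabelian Literature.IUT.LogThetaLattice Literature.IUT.LogVolume
  Literature.NumberTheory.NumberFields Literature.NumberTheory.GaloisRepresentations.Ultrametric
open Summit.ABC.IUTFork.Thm311 Summit.ABC.IUTFork.Thm311.Real Summit.ABC.IUTFork.Cor312 Summit.ABC.IUTFork.Cor312.Setting
  Summit.ABC.IUTFork.Cor312Vol Summit.ABC.IUTFork.Repair.CandInternal2RealLabels Summit.ABC.IUTFork.Repair.CandInternal2RealLabelsLicence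

/-! ## §1. One ball-shaped place: the real log-shell and the I06⋆-type cell in integer currency -/

section OnePlace

variable (p : ℕ) [Fact p.Prime]
variable (K : Type*) [NontriviallyNormedField K] [NormedAlgebra ℚ_[p] K] [IsUltrametricDist K] [ProperSpace K]

/-- **THE REAL LOG-SHELL AT A BALL-SHAPED PLACE** (`p` odd): if `log_p(𝒪_K^×) = {‖y‖ ≤ ‖ϖ‖}` (`= 𝔪_K`; tame places by abc-iut-w5-d180
`logUnits_eq_closedBall_of_tame`, the boundary `e = p − 1` without `ζ_p` by abc-iut-w6-d060 `TorsionFree.logUnits_eq_closedBall_of_le_pred`)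
then `ℐ_K = p⁻¹·log_p(𝒪_K^×) = {‖y‖ ≤ ‖ϖ‖^{1−e}}` ([AbsTopIII] Def. 5.4 (iii) `ℐ = (p*)⁻¹·log_p(𝒪^×)`, `‖p‖ = ‖ϖ‖^e`).
[cite: MochizukiAbsTopIII2015, Def 5.4 (iii) p. 126] [cite: NeukirchANT1999, Ch. II Prop. (5.5)–(5.7)] [claim: Mochizuki2012, status: disputed] -/
theorem logShell_eq_closedBall_of_ball (hp : p ≠ 2) {ϖ : Kˣ} (hϖ : IsUniformizer ϖ)
    (hball : logUnits K = closedBall (0 : K) ‖(ϖ : K)‖) :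
    logShell (PadicLogOnUnits.ofUnitLog p K) = closedBall (0 : K) (‖(ϖ : K)‖ ^ ((1 : ℤ) - absRamificationIdx p K)) := by
  have hϖ0 : 0 < ‖(ϖ : K)‖ := norm_units_pos ϖ
  have hc0 := pstarNat_cast_ne_zero p K
  rw [logShell_ofUnitLog, hball, smul_closedBall' (inv_ne_zero hc0), smul_zero, norm_inv, norm_pstarNat_cast p K, if_neg hp,
    pow_one, ← norm_pow_absRamificationIdx p K hϖ]
  congr 1
  rw [zpow_sub₀ hϖ0.ne', zpow_one, zpow_natCast, div_eq_mul_inv, mul_comm]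

/-- **THE REAL I06⋆-TYPE CELL AT A BALL-SHAPED PLACE, INTEGER currency** (START-HERE v1.1 §1 «BALL-SHELL CLOSED FORM» as a kernel iff):
`p` odd, `log_p 𝒪_K^× = 𝔪_K`, `q ≠ 0` with `‖q‖ = ‖ϖ‖^m`: **`q ∈ qⁿ · ℐ_K ⟺ (n − 1)·m ≤ e − 1`** — abc-iut-rp-d2's tame window
(`mem_pow_smul_logShell_iff_of_le`, part 1 `mem_pow_smul_logShell_iff_int_of_tame_unif`) with «`e ≤ p − 2`» replaced by the ball hypothesis.
[cite: MochizukiAbsTopIII2015, Def 5.4 (iii) p. 126] [cite: Mochizuki2012, IUTchIV Prop. 1.2 (i)(ii) p. 10] [claim: Mochizuki2012, status: disputed] -/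
theorem mem_pow_smul_logShell_iff_int_of_ball (hp : p ≠ 2) {ϖ : Kˣ} (hϖ : IsUniformizer ϖ)
    (hball : logUnits K = closedBall (0 : K) ‖(ϖ : K)‖) {q : K} (hq : q ≠ 0) {m : ℤ} (hqm : ‖q‖ = ‖(ϖ : K)‖ ^ m) (n : ℕ) :
    q ∈ q ^ n • logShell (PadicLogOnUnits.ofUnitLog p K) ↔ ((n : ℤ) - 1) * m ≤ (absRamificationIdx p K : ℤ) - 1 := by
  have hϖ0 : 0 < ‖(ϖ : K)‖ := norm_units_pos ϖ
  have hϖ1 : ‖(ϖ : K)‖ < 1 := hϖ.1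
  rw [logShell_eq_closedBall_of_ball p K hp hϖ hball, Set.mem_smul_set_iff_inv_smul_mem₀ (pow_ne_zero n hq), mem_closedBall_zero_iff,
    smul_eq_mul, norm_mul, norm_inv, norm_pow, hqm, ← zpow_natCast, ← zpow_neg, ← zpow_mul, ← zpow_add₀ hϖ0.ne',
    zpow_le_zpow_iff_right_of_lt_one₀ hϖ0 hϖ1]
  constructor <;> intro h <;> linarith

end OnePlace

/-! ## §2. The sharp real setting, one uniformly-indexed BALL fibre over an odd prime -/

section Setting

variable {F : Type} [Field F] [NumberField F] (X : PilotData F) {logv : PadicLogs F} (hlog : LogvAnalytic logv)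
  (M : Type) [Field M] [NumberField M]
  (archPk : ∀ (j : (thetaIndex X).Label) (vQ : (thetaIndex X).VQ), Set ((logShellsDH X logv).Packet j vQ))
  (archSub : ∀ (j : (thetaIndex X).Label) (v : (thetaIndex X).V),
    Set ((logShellsDH X logv).Packet j ((thetaIndex X).over v)))
  (Ψ : ℤ → ∀ v : (thetaIndex X).V, v ∈ (thetaIndex X).Vbad → Set ((logShellsDH X logv).StarPacket v))
  (act : ℤ → ∀ v : (thetaIndex X).V, v ∈ (thetaIndex X).Vbad →
    (logShellsDH X logv).StarPacket v → Module.End ℚ ((logShellsDH X logv).StarPacket v))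
  (Mmod : ℤ → ∀ j : (thetaIndex X).LabelStar, Set ((logShellsDH X logv).GlobalPacket j.1))
  (region : ℤ → ∀ j : (thetaIndex X).LabelStar, FinDivisor M → ∀ vQ : (thetaIndex X).VQ,
    Set ((logShellsDH X logv).Packet j.1 vQ))
  (n : ℤ) {HT : Type} {LogLink : HT → HT → Type} {IsFull : ∀ {s t : HT}, LogLink s t → Prop}
  (lat : LGPGaussianLogThetaLattice LogLink IsFull)
  {Frd : Type} {IsoF : Frd → Frd → Type} {Ob : Frd → Type} {realify : Frd → Frd} {Strip : Type}
  {IsoS : Strip → Strip → Type} {Mv : ∀ v : (thetaIndex X).V, v ∈ (thetaIndex X).Vbad → Type}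
  [∀ v h, Monoid (Mv v h)]
  (sig : GlobalLGPFrobenioidSignature (thetaIndex X).lstar (thetaIndex X).V (· ∈ (thetaIndex X).Vbad)
    Frd IsoF Ob realify Strip IsoS Mv)
  (split : SplittingMonoids Mv) {ObΔ : Type} {N : ∀ v : (thetaIndex X).V, v ∈ (thetaIndex X).Vbad → Type}
  [∀ v h, Monoid (N v h)] (qData : QPilotData ObΔ N)
  (tq : ∀ (pp : Nat.Primes) (x : (thetaIndex X).Fibre (.inr pp)), haveI : Fact (pp : ℕ).Prime := ⟨pp.2⟩; kOf X pp.1 x)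
  (t : ∀ (pp : Nat.Primes) (_ : Fin X.lstar) (x : (thetaIndex X).Fibre (.inr pp)),
    haveI : Fact (pp : ℕ).Prime := ⟨pp.2⟩; kOf X pp.1 x)
  (htq0 : ∀ pp x, tq pp x ≠ 0)
  (htq1 : ∀ (pp : Nat.Primes) (x : (thetaIndex X).Fibre (.inr pp)),
    haveI : Fact (pp : ℕ).Prime := ⟨pp.2⟩; placeOf X pp.1 x ∉ X.S → ‖tq pp x‖ = 1)

/-- **THE k2 IMPLICATION PER CELL AT A BALL FIBRE: the real I06⋆ cell at the places over `p` gives the (xi-f) licence cell at `(j, p)`**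
(`j = i+1`). At abc-iut-c312-3's `settingDHVolSharp`, over an odd prime `p` whose fibre consists of BALL places of one index (`e(x|p) = e`,
norm uniformizers `ϖ_x`, `log_p 𝒪_x^× = {‖y‖ ≤ ‖ϖ_x‖}` at every `x | p` — tame, or `e = p − 1` without `ζ_p`), with HONEST integer exponents
`‖t_{q,w}‖ = ‖ϖ_w‖^{m_q(w)}`, `‖t_{Θ,j,w}‖ = ‖ϖ_w‖^{j²·m_q(w)}`, `m_q(w) ≥ 1`: if at every `w | p` the q-idele lies in the `j²`-power log-shell
orbit `t_{q,w} ∈ t_{q,w}^{j²} · ℐ_{K_w}` (the REAL I06⋆ cell), then the q-pilot region at `(j, p)` lies in `ⁿ˚𝒰_{j,p}`. Route: §1 ⟹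
`(j²−1)·m_q ≤ e − 1 ≤ j·(e−1)` ⟹ abc-iut-w5-d009's `tame_exact_of_sufficient_leg` ⟹ abc-iut-D1-prv's ball movers through p456193.
[cite: DupuyHilado2025, §3.4, §3.9, §4.9] [cite: Mochizuki2012, IUTchIV Prop. 1.2 (i)(ii) p. 10] [claim: Mochizuki2012, status: disputed] -/
theorem qRegion_subset_thetaHull_settingDHVolSharp_of_realStar_ball (i : Fin (thetaIndex X).lstar) (pp : Nat.Primes)
    (hp2 : 2 < (pp : ℕ)) (e : ℕ)
    (ϖ : haveI : Fact (pp : ℕ).Prime := ⟨pp.2⟩; ∀ x : (thetaIndex X).Fibre (.inr pp), (kOf X pp.1 x)ˣ)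
    (hfib : haveI : Fact (pp : ℕ).Prime := ⟨pp.2⟩
      ∀ x : (thetaIndex X).Fibre (.inr pp), (placeOf X pp.1 x).asIdeal.ramificationIdx ℤ = e ∧ IsUniformizer (ϖ x) ∧
        logUnits (kOf X pp.1 x) = closedBall (0 : kOf X pp.1 x) ‖(ϖ x : kOf X pp.1 x)‖)
    (mq : (thetaIndex X).Fibre (.inr pp) → ℤ)
    (hΘ : haveI : Fact (pp : ℕ).Prime := ⟨pp.2⟩
      ∀ w : (thetaIndex X).Fibre (.inr pp), ‖t pp i w‖ = ‖(ϖ w : kOf X pp.1 w)‖ ^ (((((i : ℕ) + 1) ^ 2 : ℕ) : ℤ) * mq w))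
    (hq : haveI : Fact (pp : ℕ).Prime := ⟨pp.2⟩
      ∀ w : (thetaIndex X).Fibre (.inr pp), ‖tq pp w‖ = ‖(ϖ w : kOf X pp.1 w)‖ ^ mq w)
    (h1 : ∀ w, 1 ≤ mq w)
    (hstar : haveI : Fact (pp : ℕ).Prime := ⟨pp.2⟩
      ∀ w : (thetaIndex X).Fibre (.inr pp),
        tq pp w ∈ tq pp w ^ (((i : ℕ) + 1) ^ 2) • logShell (PadicLogOnUnits.ofUnitLog (pp : ℕ) (kOf X pp.1 w))) :
    (settingDHVolSharp X hlog M archPk archSub Ψ act Mmod region n lat sig split qData tq t htq0 htq1).qRegion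
        (labelSucc i) (.inr pp) ⊆
      (settingDHVolSharp X hlog M archPk archSub Ψ act Mmod region n lat sig split qData tq t htq0 htq1).thetaHull
        (labelSucc i) (.inr pp) := by
  haveI hF : Fact (pp : ℕ).Prime := ⟨pp.2⟩
  refine (qRegion_subset_thetaHull_settingDHVolSharp_iff_of_ball_orders X hlog M archPk archSub Ψ act Mmod region n lat sig split
    qData tq t htq0 htq1 i pp hp2 e ϖ hfib (fun w => ((((i : ℕ) + 1) ^ 2 : ℕ) : ℤ) * mq w) mq hΘ hq ?_).2 ?_
  · -- `1 ≤ j²·m_q`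
    intro w
    have hj : (1 : ℤ) ≤ ((((i : ℕ) + 1) ^ 2 : ℕ) : ℤ) := by exact_mod_cast Nat.one_le_pow _ _ (Nat.succ_pos i)
    nlinarith [h1 w]
  · intro w
    have heK : absRamificationIdx (pp : ℕ) (kOf X pp.1 w) = e :=
      (absRamificationIdx_rescaledCompletion F (pp : ℕ) (placeOf X pp.1 w) (natCast_mem_placeOf X pp.1 w)).trans (hfib w).1
    have he1 : (1 : ℤ) ≤ e := by
      have := absRamificationIdx_pos (pp : ℕ) (kOf X pp.1 w)
      rw [heK] at this
      exact_mod_cast this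
    -- the I06⋆ cell in integer currency: `(j² − 1)·m_q ≤ e − 1`
    have hle := (mem_pow_smul_logShell_iff_int_of_ball (pp : ℕ) (kOf X pp.1 w) (Nat.ne_of_gt hp2) (hfib w).2.1 (hfib w).2.2 (htq0 pp w) (hq w)
      (((i : ℕ) + 1) ^ 2)).1 (hstar w)
    rw [heK] at hle
    -- w5-d009's sufficient leg at `L = j`
    have hsuff : (((i : ℤ) + 1) ^ 2 - 1) * mq w ≤ ((i : ℤ) + 1) * ((e : ℤ) - 1) := by
      push_cast at hle
      have hm : 0 ≤ mq w := le_trans zero_le_one (h1 w)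
      nlinarith [hle, he1, hm]
    have hex := tame_exact_of_sufficient_leg (e := (e : ℤ)) (j := (i : ℤ) + 1) (L := (i : ℤ) + 1) (P := mq w) he1
      (le_trans zero_le_one (h1 w)) (by omega) le_rfl hsuff
    push_cast
    exact hex

/-- **THE LICENCE CELL FORCES THE LINEAR SHELL CELL** (same ball fibre): if the q-pilot region at `(j, p)` lies in `ⁿ˚𝒰_{j,p}`, then at every
`w | p` the q-idele lies in the `j`-power (LINEAR exponent) log-shell orbit `t_{q,w} ∈ t_{q,w}^{j} · ℐ_{K_w}` — abc-iut-w5-d009's necessary leg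
`(j−1)·m_q ≤ e−1` read back through §1. [cite: DupuyHilado2025, §3.4, §4.9] [cite: Mochizuki2012, IUTchIV Prop. 1.2 (i)(ii) p. 10]
[claim: Mochizuki2012, status: disputed] -/
theorem realLinear_of_qRegion_subset_thetaHull_settingDHVolSharp_ball (i : Fin (thetaIndex X).lstar) (pp : Nat.Primes)
    (hp2 : 2 < (pp : ℕ)) (e : ℕ)
    (ϖ : haveI : Fact (pp : ℕ).Prime := ⟨pp.2⟩; ∀ x : (thetaIndex X).Fibre (.inr pp), (kOf X pp.1 x)ˣ)
    (hfib : haveI : Fact (pp : ℕ).Prime := ⟨pp.2⟩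
      ∀ x : (thetaIndex X).Fibre (.inr pp), (placeOf X pp.1 x).asIdeal.ramificationIdx ℤ = e ∧ IsUniformizer (ϖ x) ∧
        logUnits (kOf X pp.1 x) = closedBall (0 : kOf X pp.1 x) ‖(ϖ x : kOf X pp.1 x)‖)
    (mq : (thetaIndex X).Fibre (.inr pp) → ℤ)
    (hΘ : haveI : Fact (pp : ℕ).Prime := ⟨pp.2⟩
      ∀ w : (thetaIndex X).Fibre (.inr pp), ‖t pp i w‖ = ‖(ϖ w : kOf X pp.1 w)‖ ^ (((((i : ℕ) + 1) ^ 2 : ℕ) : ℤ) * mq w))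
    (hq : haveI : Fact (pp : ℕ).Prime := ⟨pp.2⟩
      ∀ w : (thetaIndex X).Fibre (.inr pp), ‖tq pp w‖ = ‖(ϖ w : kOf X pp.1 w)‖ ^ mq w)
    (h1 : ∀ w, 1 ≤ mq w)
    (hincl : (settingDHVolSharp X hlog M archPk archSub Ψ act Mmod region n lat sig split qData tq t htq0 htq1).qRegion
        (labelSucc i) (.inr pp) ⊆
      (settingDHVolSharp X hlog M archPk archSub Ψ act Mmod region n lat sig split qData tq t htq0 htq1).thetaHull
        (labelSucc i) (.inr pp)) :
    haveI : Fact (pp : ℕ).Prime := ⟨pp.2⟩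
    ∀ w : (thetaIndex X).Fibre (.inr pp),
      tq pp w ∈ tq pp w ^ ((i : ℕ) + 1) • logShell (PadicLogOnUnits.ofUnitLog (pp : ℕ) (kOf X pp.1 w)) := by
  haveI hF : Fact (pp : ℕ).Prime := ⟨pp.2⟩
  intro w
  have hall := (qRegion_subset_thetaHull_settingDHVolSharp_iff_of_ball_orders X hlog M archPk archSub Ψ act Mmod region n lat sig split
    qData tq t htq0 htq1 i pp hp2 e ϖ hfib (fun w => ((((i : ℕ) + 1) ^ 2 : ℕ) : ℤ) * mq w) mq hΘ hq (fun w => by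
      have hj : (1 : ℤ) ≤ ((((i : ℕ) + 1) ^ 2 : ℕ) : ℤ) := by exact_mod_cast Nat.one_le_pow _ _ (Nat.succ_pos i)
      nlinarith [h1 w])).1 hincl w
  have heK : absRamificationIdx (pp : ℕ) (kOf X pp.1 w) = e :=
    (absRamificationIdx_rescaledCompletion F (pp : ℕ) (placeOf X pp.1 w) (natCast_mem_placeOf X pp.1 w)).trans (hfib w).1
  have he1 : (1 : ℤ) ≤ e := by
    have := absRamificationIdx_pos (pp : ℕ) (kOf X pp.1 w)
    rw [heK] at this
    exact_mod_cast this
  have hex : (e : ℤ) * ((((i : ℤ) + 1) ^ 2 * mq w - 1) / e) + 1 - ((i : ℤ) + 1) * ((e : ℤ) - 1) ≤ mq w := by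
    push_cast at hall
    exact hall
  have hnec := necessary_leg_of_tame_exact (e := (e : ℤ)) (L := (i : ℤ) + 1) (P := mq w) he1 (by omega) hex
  refine (mem_pow_smul_logShell_iff_int_of_ball (pp : ℕ) (kOf X pp.1 w) (Nat.ne_of_gt hp2) (hfib w).2.1 (hfib w).2.2 (htq0 pp w) (hq w)
    ((i : ℕ) + 1)).2 ?_
  rw [heK]
  push_cast
  linarith

/-! ## §3. All bad fibres uniform ball fibres over odd primes: the licence and branch C's S_H antecedent from the I06⋆ cells -/

/-- **THE (xi-f) LICENCE at `settingPrVolSharp` FROM THE REAL I06⋆ CELLS**, all bad fibres uniform BALL fibres over odd primes. Θ-ideles units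
off `S`; at every prime `p` under `S`: `p > 2`, one index `e_p`, uniformizers, `log_p 𝒪_x^× = 𝔪_x` at every `x | p`; at every bad `w | p` honest integer exponents
`‖t_{q,w}‖ = ‖ϖ_w‖^{m_q(w)}`, `‖t_{Θ,j,w}‖ = ‖ϖ_w‖^{j²·m_q(w)}`, `m_q(w) ≥ 1`; and at every bad `w` and every label `j ∈ 𝔽_l^⋇` the REAL I06⋆ cell
`t_{q,w} ∈ t_{q,w}^{j²}·ℐ_{K_w}`. THEN abc-iut-c312-1's `Thm311ToCor312.Licence` holds at abc-iut-c312-7's `settingPrVolSharp`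
(abc-iut-D1-prv `licence_settingPrVolSharp_iff_of_ball_orders`, p456193, (←) leg fed by §1). [cite: DupuyHilado2025, §3.4, §3.9, §4.9]
[cite: Mochizuki2012, IUTchIV Prop. 1.2 (i)(ii) p. 10] [claim: Mochizuki2012, status: disputed] -/
theorem licence_settingPrVolSharp_of_realStar_ball
    (ht1 : ∀ (pp : Nat.Primes) (i : Fin X.lstar) (x : (thetaIndex X).Fibre (.inr pp)),
      haveI : Fact (pp : ℕ).Prime := ⟨pp.2⟩; placeOf X pp.1 x ∉ X.S → ‖t pp i x‖ = 1)
    (e : Nat.Primes → ℕ)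
    (ϖ : ∀ (pp : Nat.Primes) (x : (thetaIndex X).Fibre (.inr pp)), haveI : Fact (pp : ℕ).Prime := ⟨pp.2⟩; (kOf X pp.1 x)ˣ)
    (hfib : ∀ (pp : Nat.Primes) (x : (thetaIndex X).Fibre (.inr pp)),
      haveI : Fact (pp : ℕ).Prime := ⟨pp.2⟩
      (∃ w : (thetaIndex X).Fibre (.inr pp), placeOf X pp.1 w ∈ X.S) →
        2 < (pp : ℕ) ∧ (placeOf X pp.1 x).asIdeal.ramificationIdx ℤ = e pp ∧ IsUniformizer (ϖ pp x) ∧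
          logUnits (kOf X pp.1 x) = closedBall (0 : kOf X pp.1 x) ‖(ϖ pp x : kOf X pp.1 x)‖)
    (mq : ∀ pp : Nat.Primes, (thetaIndex X).Fibre (.inr pp) → ℤ)
    (hΘ : ∀ (pp : Nat.Primes) (i : Fin (thetaIndex X).lstar) (w : (thetaIndex X).Fibre (.inr pp)),
      haveI : Fact (pp : ℕ).Prime := ⟨pp.2⟩
      placeOf X pp.1 w ∈ X.S → ‖t pp i w‖ = ‖(ϖ pp w : kOf X pp.1 w)‖ ^ (((((i : ℕ) + 1) ^ 2 : ℕ) : ℤ) * mq pp w))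
    (hq : ∀ (pp : Nat.Primes) (w : (thetaIndex X).Fibre (.inr pp)),
      haveI : Fact (pp : ℕ).Prime := ⟨pp.2⟩
      placeOf X pp.1 w ∈ X.S → ‖tq pp w‖ = ‖(ϖ pp w : kOf X pp.1 w)‖ ^ mq pp w)
    (h1 : ∀ (pp : Nat.Primes) (w : (thetaIndex X).Fibre (.inr pp)),
      haveI : Fact (pp : ℕ).Prime := ⟨pp.2⟩; placeOf X pp.1 w ∈ X.S → 1 ≤ mq pp w)
    (hstar : ∀ (pp : Nat.Primes) (i : Fin (thetaIndex X).lstar) (w : (thetaIndex X).Fibre (.inr pp)),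
      haveI : Fact (pp : ℕ).Prime := ⟨pp.2⟩
      placeOf X pp.1 w ∈ X.S →
        tq pp w ∈ tq pp w ^ (((i : ℕ) + 1) ^ 2) • logShell (PadicLogOnUnits.ofUnitLog (pp : ℕ) (kOf X pp.1 w))) :
    Thm311ToCor312.Licence (settingPrVolSharp X hlog M archPk archSub Ψ act Mmod region n lat sig split qData tq t htq0 htq1) := by
  refine (licence_settingPrVolSharp_iff_of_ball_orders X hlog M archPk archSub Ψ act Mmod region n lat sig split qData tq t htq0 htq1
    ht1 e ϖ hfib (fun pp i w => ((((i : ℕ) + 1) ^ 2 : ℕ) : ℤ) * mq pp w) mq hΘ hq ?_).2 ?_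
  · intro pp i w hw
    have hj : (1 : ℤ) ≤ ((((i : ℕ) + 1) ^ 2 : ℕ) : ℤ) := by exact_mod_cast Nat.one_le_pow _ _ (Nat.succ_pos i)
    nlinarith [h1 pp w hw]
  · intro pp i w hw
    haveI hF : Fact (pp : ℕ).Prime := ⟨pp.2⟩
    obtain ⟨hp2, hram, hunif, hΛ⟩ := hfib pp w ⟨w, hw⟩
    have heK : absRamificationIdx (pp : ℕ) (kOf X pp.1 w) = e pp :=
      (absRamificationIdx_rescaledCompletion F (pp : ℕ) (placeOf X pp.1 w) (natCast_mem_placeOf X pp.1 w)).trans hram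
    have he1 : (1 : ℤ) ≤ e pp := by
      have := absRamificationIdx_pos (pp : ℕ) (kOf X pp.1 w)
      rw [heK] at this
      exact_mod_cast this
    have hle := (mem_pow_smul_logShell_iff_int_of_ball (pp : ℕ) (kOf X pp.1 w) (Nat.ne_of_gt hp2) hunif hΛ (htq0 pp w) (hq pp w hw)
      (((i : ℕ) + 1) ^ 2)).1 (hstar pp i w hw)
    rw [heK] at hle
    have hm : 0 ≤ mq pp w := le_trans zero_le_one (h1 pp w hw)
    have hsuff : (((i : ℤ) + 1) ^ 2 - 1) * mq pp w ≤ ((i : ℤ) + 1) * ((e pp : ℤ) - 1) := by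
      push_cast at hle
      nlinarith [hle, he1, hm]
    have hex := tame_exact_of_sufficient_leg (e := (e pp : ℤ)) (j := (i : ℤ) + 1) (L := (i : ℤ) + 1) (P := mq pp w) he1 hm
      (by omega) le_rfl hsuff
    push_cast
    exact hex

/-- **… hence BRANCH C's PER-DATUM S_H ANTECEDENT «∃ ρ qK, QPinned ∧ PilotKummerCompatHull»** at `settingPrVolSharp` (any columns `col`;
q-ideles of norm `≤ 1`, abc-iut-w5-d009's `exists_qPinned_and_hull_settingPrVolSharp_iff_licence`). The k2 target shape of R-H (START-HERE §3
(k2)) reached from the I06⋆ cells at data whose bad fibres are ball fibres. [cite: DupuyHilado2025, §3.4, §3.9, §4.9] [claim: Mochizuki2012, status: disputed] -/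
theorem exists_qPinned_and_hull_settingPrVolSharp_of_realStar_ball (col : ℤ → Column (logShellsDH X logv))
    (htqle : ∀ pp x, ‖tq pp x‖ ≤ 1)
    (ht1 : ∀ (pp : Nat.Primes) (i : Fin X.lstar) (x : (thetaIndex X).Fibre (.inr pp)),
      haveI : Fact (pp : ℕ).Prime := ⟨pp.2⟩; placeOf X pp.1 x ∉ X.S → ‖t pp i x‖ = 1)
    (e : Nat.Primes → ℕ)
    (ϖ : ∀ (pp : Nat.Primes) (x : (thetaIndex X).Fibre (.inr pp)), haveI : Fact (pp : ℕ).Prime := ⟨pp.2⟩; (kOf X pp.1 x)ˣ)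
    (hfib : ∀ (pp : Nat.Primes) (x : (thetaIndex X).Fibre (.inr pp)),
      haveI : Fact (pp : ℕ).Prime := ⟨pp.2⟩
      (∃ w : (thetaIndex X).Fibre (.inr pp), placeOf X pp.1 w ∈ X.S) →
        2 < (pp : ℕ) ∧ (placeOf X pp.1 x).asIdeal.ramificationIdx ℤ = e pp ∧ IsUniformizer (ϖ pp x) ∧
          logUnits (kOf X pp.1 x) = closedBall (0 : kOf X pp.1 x) ‖(ϖ pp x : kOf X pp.1 x)‖)
    (mq : ∀ pp : Nat.Primes, (thetaIndex X).Fibre (.inr pp) → ℤ)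
    (hΘ : ∀ (pp : Nat.Primes) (i : Fin (thetaIndex X).lstar) (w : (thetaIndex X).Fibre (.inr pp)),
      haveI : Fact (pp : ℕ).Prime := ⟨pp.2⟩
      placeOf X pp.1 w ∈ X.S → ‖t pp i w‖ = ‖(ϖ pp w : kOf X pp.1 w)‖ ^ (((((i : ℕ) + 1) ^ 2 : ℕ) : ℤ) * mq pp w))
    (hq : ∀ (pp : Nat.Primes) (w : (thetaIndex X).Fibre (.inr pp)),
      haveI : Fact (pp : ℕ).Prime := ⟨pp.2⟩
      placeOf X pp.1 w ∈ X.S → ‖tq pp w‖ = ‖(ϖ pp w : kOf X pp.1 w)‖ ^ mq pp w)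
    (h1 : ∀ (pp : Nat.Primes) (w : (thetaIndex X).Fibre (.inr pp)),
      haveI : Fact (pp : ℕ).Prime := ⟨pp.2⟩; placeOf X pp.1 w ∈ X.S → 1 ≤ mq pp w)
    (hstar : ∀ (pp : Nat.Primes) (i : Fin (thetaIndex X).lstar) (w : (thetaIndex X).Fibre (.inr pp)),
      haveI : Fact (pp : ℕ).Prime := ⟨pp.2⟩
      placeOf X pp.1 w ∈ X.S →
        tq pp w ∈ tq pp w ^ (((i : ℕ) + 1) ^ 2) • logShell (PadicLogOnUnits.ofUnitLog (pp : ℕ) (kOf X pp.1 w))) :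
    ∃ (ρ : (∀ v : (thetaIndex X).V, v ∈ (thetaIndex X).Vbad → Set ((logShellsDH X logv).StarPacket v)) →
          ∀ (j : (thetaIndex X).Label) (vQ : (thetaIndex X).VQ), Set ((logShellsDH X logv).Packet j vQ))
        (qK : ∀ v : (thetaIndex X).V, v ∈ (thetaIndex X).Vbad → Set ((logShellsDH X logv).StarPacket v)),
        QPinned ({ toSituation := situationPrVol X hlog M archPk archSub Ψ act Mmod region, col := col } :
            LatticeSituation (thetaIndex X))
          (settingPrVolSharp X hlog M archPk archSub Ψ act Mmod region n lat sig split qData tq t htq0 htq1) ρ qK ∧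
        PilotKummerCompatHull ({ toSituation := situationPrVol X hlog M archPk archSub Ψ act Mmod region, col := col } :
            LatticeSituation (thetaIndex X))
          (settingPrVolSharp X hlog M archPk archSub Ψ act Mmod region n lat sig split qData tq t htq0 htq1) ρ qK :=
  (exists_qPinned_and_hull_settingPrVolSharp_iff_licence X hlog M archPk archSub Ψ act Mmod region n lat sig split qData tq t htq0 htq1
      col htqle).2
    (licence_settingPrVolSharp_of_realStar_ball X hlog M archPk archSub Ψ act Mmod region n lat sig split qData tq t htq0 htq1 ht1 e ϖ
      hfib mq hΘ hq h1 hstar)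

/-- **THE LICENCE FORCES THE LINEAR SHELL CELLS at every bad ball place and every label** (necessity, licence level).
[cite: DupuyHilado2025, §3.4, §4.9] [claim: Mochizuki2012, status: disputed] -/
theorem realLinear_of_licence_settingPrVolSharp_ball
    (ht1 : ∀ (pp : Nat.Primes) (i : Fin X.lstar) (x : (thetaIndex X).Fibre (.inr pp)),
      haveI : Fact (pp : ℕ).Prime := ⟨pp.2⟩; placeOf X pp.1 x ∉ X.S → ‖t pp i x‖ = 1)
    (e : Nat.Primes → ℕ)
    (ϖ : ∀ (pp : Nat.Primes) (x : (thetaIndex X).Fibre (.inr pp)), haveI : Fact (pp : ℕ).Prime := ⟨pp.2⟩; (kOf X pp.1 x)ˣ)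
    (hfib : ∀ (pp : Nat.Primes) (x : (thetaIndex X).Fibre (.inr pp)),
      haveI : Fact (pp : ℕ).Prime := ⟨pp.2⟩
      (∃ w : (thetaIndex X).Fibre (.inr pp), placeOf X pp.1 w ∈ X.S) →
        2 < (pp : ℕ) ∧ (placeOf X pp.1 x).asIdeal.ramificationIdx ℤ = e pp ∧ IsUniformizer (ϖ pp x) ∧
          logUnits (kOf X pp.1 x) = closedBall (0 : kOf X pp.1 x) ‖(ϖ pp x : kOf X pp.1 x)‖)
    (mq : ∀ pp : Nat.Primes, (thetaIndex X).Fibre (.inr pp) → ℤ)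
    (hΘ : ∀ (pp : Nat.Primes) (i : Fin (thetaIndex X).lstar) (w : (thetaIndex X).Fibre (.inr pp)),
      haveI : Fact (pp : ℕ).Prime := ⟨pp.2⟩
      placeOf X pp.1 w ∈ X.S → ‖t pp i w‖ = ‖(ϖ pp w : kOf X pp.1 w)‖ ^ (((((i : ℕ) + 1) ^ 2 : ℕ) : ℤ) * mq pp w))
    (hq : ∀ (pp : Nat.Primes) (w : (thetaIndex X).Fibre (.inr pp)),
      haveI : Fact (pp : ℕ).Prime := ⟨pp.2⟩
      placeOf X pp.1 w ∈ X.S → ‖tq pp w‖ = ‖(ϖ pp w : kOf X pp.1 w)‖ ^ mq pp w)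
    (h1 : ∀ (pp : Nat.Primes) (w : (thetaIndex X).Fibre (.inr pp)),
      haveI : Fact (pp : ℕ).Prime := ⟨pp.2⟩; placeOf X pp.1 w ∈ X.S → 1 ≤ mq pp w)
    (hL : Thm311ToCor312.Licence (settingPrVolSharp X hlog M archPk archSub Ψ act Mmod region n lat sig split qData tq t htq0 htq1)) :
    ∀ (pp : Nat.Primes) (i : Fin (thetaIndex X).lstar) (w : (thetaIndex X).Fibre (.inr pp)),
      haveI : Fact (pp : ℕ).Prime := ⟨pp.2⟩
      placeOf X pp.1 w ∈ X.S →
        tq pp w ∈ tq pp w ^ ((i : ℕ) + 1) • logShell (PadicLogOnUnits.ofUnitLog (pp : ℕ) (kOf X pp.1 w)) := by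
  intro pp i w hw
  haveI hF : Fact (pp : ℕ).Prime := ⟨pp.2⟩
  have hall := (licence_settingPrVolSharp_iff_of_ball_orders X hlog M archPk archSub Ψ act Mmod region n lat sig split qData tq t htq0
    htq1 ht1 e ϖ hfib (fun pp i w => ((((i : ℕ) + 1) ^ 2 : ℕ) : ℤ) * mq pp w) mq hΘ hq (fun pp i w hw => by
      have hj : (1 : ℤ) ≤ ((((i : ℕ) + 1) ^ 2 : ℕ) : ℤ) := by exact_mod_cast Nat.one_le_pow _ _ (Nat.succ_pos i)
      nlinarith [h1 pp w hw])).1 hL pp i w hw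
  obtain ⟨hp2, hram, hunif, hΛ⟩ := hfib pp w ⟨w, hw⟩
  have heK : absRamificationIdx (pp : ℕ) (kOf X pp.1 w) = e pp :=
    (absRamificationIdx_rescaledCompletion F (pp : ℕ) (placeOf X pp.1 w) (natCast_mem_placeOf X pp.1 w)).trans hram
  have he1 : (1 : ℤ) ≤ e pp := by
    have := absRamificationIdx_pos (pp : ℕ) (kOf X pp.1 w)
    rw [heK] at this
    exact_mod_cast this
  have hex : (e pp : ℤ) * ((((i : ℤ) + 1) ^ 2 * mq pp w - 1) / e pp) + 1 - ((i : ℤ) + 1) * ((e pp : ℤ) - 1) ≤ mq pp w := by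
    push_cast at hall
    exact hall
  have hnec := necessary_leg_of_tame_exact (e := (e pp : ℤ)) (L := (i : ℤ) + 1) (P := mq pp w) he1 (by omega) hex
  refine (mem_pow_smul_logShell_iff_int_of_ball (pp : ℕ) (kOf X pp.1 w) (Nat.ne_of_gt hp2) hunif hΛ (htq0 pp w) (hq pp w hw)
    ((i : ℕ) + 1)).2 ?_
  rw [heK]
  push_cast
  linarith

/-- **(B) THE LICENCE CELL EXACTLY, IN I06⋆ CURRENCY** (START-HERE v1.1 §3 (L1)) at the ball fibre of (A): q-region at `(j, p)` ⊆ `ⁿ˚𝒰_{j,p}`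
**iff** `∀ w | p, (j²−1)·m_q(w) − j·(e−1) ≤ (j²·m_q(w) − 1) mod e` (p456193 through abc-iut-w5-d009's `tame_exact_iff_emod`); next to §1's I06⋆
cell `(j²−1)·m_q(w) ≤ e−1` this is the band `θ_j ∈ [1, j]`. [cite: DupuyHilado2025, §3.4, §4.9] [claim: Mochizuki2012, status: disputed] -/
theorem qRegion_subset_thetaHull_settingDHVolSharp_iff_emod_ball (i : Fin (thetaIndex X).lstar) (pp : Nat.Primes) (hp2 : 2 < (pp : ℕ))
    (e : ℕ) (ϖ : haveI : Fact (pp : ℕ).Prime := ⟨pp.2⟩; ∀ x : (thetaIndex X).Fibre (.inr pp), (kOf X pp.1 x)ˣ)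
    (hfib : haveI : Fact (pp : ℕ).Prime := ⟨pp.2⟩; ∀ x, (placeOf X pp.1 x).asIdeal.ramificationIdx ℤ = e ∧ IsUniformizer (ϖ x) ∧
      logUnits (kOf X pp.1 x) = closedBall (0 : kOf X pp.1 x) ‖(ϖ x : kOf X pp.1 x)‖)
    (mq : (thetaIndex X).Fibre (.inr pp) → ℤ)
    (hΘ : haveI : Fact (pp : ℕ).Prime := ⟨pp.2⟩; ∀ w, ‖t pp i w‖ = ‖(ϖ w : kOf X pp.1 w)‖ ^ (((((i : ℕ) + 1) ^ 2 : ℕ) : ℤ) * mq w))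
    (hq : haveI : Fact (pp : ℕ).Prime := ⟨pp.2⟩; ∀ w, ‖tq pp w‖ = ‖(ϖ w : kOf X pp.1 w)‖ ^ mq w) (h1 : ∀ w, 1 ≤ mq w) :
    (settingDHVolSharp X hlog M archPk archSub Ψ act Mmod region n lat sig split qData tq t htq0 htq1).qRegion (labelSucc i) (.inr pp) ⊆
        (settingDHVolSharp X hlog M archPk archSub Ψ act Mmod region n lat sig split qData tq t htq0 htq1).thetaHull (labelSucc i) (.inr pp) ↔
      ∀ w : (thetaIndex X).Fibre (.inr pp),
        (((i : ℤ) + 1) ^ 2 - 1) * mq w - ((i : ℤ) + 1) * ((e : ℤ) - 1) ≤ (((i : ℤ) + 1) ^ 2 * mq w - 1) % (e : ℤ) := by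
  haveI hF : Fact (pp : ℕ).Prime := ⟨pp.2⟩
  rw [qRegion_subset_thetaHull_settingDHVolSharp_iff_of_ball_orders X hlog M archPk archSub Ψ act Mmod region n lat sig split qData tq t
    htq0 htq1 i pp hp2 e ϖ hfib (fun w => ((((i : ℕ) + 1) ^ 2 : ℕ) : ℤ) * mq w) mq hΘ hq (fun w => by
      have hj : (1 : ℤ) ≤ ((((i : ℕ) + 1) ^ 2 : ℕ) : ℤ) := by exact_mod_cast Nat.one_le_pow _ _ (Nat.succ_pos i)
      nlinarith [h1 w])]
  refine forall_congr' fun w => ?_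
  have h0 := absRamificationIdx_pos (pp : ℕ) (kOf X pp.1 w)
  rw [(absRamificationIdx_rescaledCompletion F (pp : ℕ) (placeOf X pp.1 w) (natCast_mem_placeOf X pp.1 w)).trans (hfib w).1] at h0
  push_cast
  exact tame_exact_iff_emod (by exact_mod_cast h0) ((i : ℤ) + 1) (mq w)

end Setting

end Summit.ABC.IUTFork.Repair.CandInternal2RealLabelsLicenceBall

end
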